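import Literature.AlgebraicGeometry.Motives.AbelianVarietyFrobeniusTwist
import Literature.AlgebraicGeometry.Motives.RestrictScalarsPoints
import Literature.AlgebraicGeometry.RelativeSpec.FiniteGroupQuotient
import HarnessLib

/-!
# The Galois thickening `R_L X = (X ⊗_K L → Spec L → Spec K)` of a `K`-scheme: its Galois action,
# the projection `π_X : R_L X → X` and the sections `ℓ_e` on `Ω`-points

Topic `Literature/AlgebraicGeometry/Motives`, namespace `Literature.AlgebraicGeometry.Motives`.  DEFINITIONS
(`thickening`, `thickeningπ`, `thickTwist`, `thickTwistIso`, `thickeningGalAction`, `thickeningLift`) with their proved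
API; no named fact, no instance, no notation, no `sorry`.  Cell `hodgecm-mathlib`, P6 «MOD programme», organ GAL of the
sub-line `Cruxes/HLiu418/Lines/F0_P6a_ModuliDatum.lean` ED. 2 (desk F0P6a-plan (g0), statement-first sketch
`F0/P6/F0P6a-plan/sketch-ED2-thickening.v1.F0P6a-plan-g0.lean` sha16 10b2b456ace7c7da — kept NAME FOR NAME and STATEMENT
FOR STATEMENT; the socket GAL-2 `isGeometricQuotient_thickeningπ` is split off to the theorems-only sequel
`Motives/GaloisThickeningQuotient.lean`).  HC_CM is proved only modulo the printed citations until rung 0 closes; nothing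
here is about HC.

THE MATHEMATICS.  For a field extension `L ∕ K` and a `K`-scheme `X`, the THICKENING `R_L X` is the base change
`X ⊗_K L = X ×_K Spec L` REGARDED AS A `K`-SCHEME through `Spec L → Spec K` (base change followed by restriction of
scalars; [GortzWedhorn2020] §(4.8)–(4.9), and the tree's `SchemeOver.restrictScalars`, ★ `Motives/RestrictScalarsPoints`:
`thickening_obj_eq_restrictScalars`).  Its `Ω`-points over `K` are the pairs (`Ω`-point of `X`, `K`-embedding `L → Ω`).
It carries:
* the projection `π_X = pr₁ : R_L X → X` over `K` (`thickeningπ`), natural in `X` (`thickeningπ_naturality`);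
* the GALOIS ACTION of `Aut(L ∕ K)` by the twists `1 × Spec σ⁻¹` (`thickTwist`, `thickTwistIso`, `thickeningGalAction`; the
  twist `1 × Spec σ` is the one of ★ `AbelianVariety.galTwist`, [GortzWedhorn2020] (14.20), here for an arbitrary
  `K`-scheme), by `K`-automorphisms commuting with `π_X` (`thickeningGalAction_comp_π`);
* for every `K`-embedding `e : L → Ω` the SECTION `ℓ_e : X(Ω) → (R_L X)(Ω)`, `P ↦ (P, Spec e)` of `π_X` on `Ω`-points
  (`thickeningLift`, `map_thickeningπ_thickeningLift`), natural in `X` (`map_thickening_map_thickeningLift`) and moved by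
  the action according to `σ · ℓ_e = ℓ_{e ∘ σ⁻¹}` (`aut_thickeningLift`).
For `L ∕ K` finite Galois, `π_X` is a geometric quotient of `R_L X` by `Gal(L ∕ K)` ([MumfordAV1970] §7 Thm. p. 66,
[SGA1] V Prop. 1.8) — that is GAL-2, proved in the sequel from ★ `RelativeSpec/GeometricQuotientOfEtaleCover`.

CONSUMER.  The letter UP of P6a (`RecordModuliPointwiseCoreUpstairsCofinal`) takes the data `(Y, π, Γ, τ, ℓ)`; the ED.-2
census (`F0/P6/F0P6a-plan/ED2-CENSUS-P6a.v1.F0P6a-plan-g0.md` §1) instantiates them as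
`(R_{Fᵢ} M⋆_{Kc}, thickeningπ, Fᵢ ≃ₐ[F] Fᵢ, thickeningGalAction (× the level action), thickeningLift e)`.

Mathlib searched (pin): `Over.pullback`, `Over.map`, `pullback.map`, `pullback.hom_ext`, `pullback.lift_fst`∕`_snd`,
`Over.homMk`, `Over.OverMorphism.ext` (all used); Mathlib has no Weil restriction ∕ restriction-of-scalars functor for
schemes under a dedicated name (the tree's `SchemeOver.restrictScalars` is `Over.map`).

## References
* [GortzWedhorn2020] U. Görtz, T. Wedhorn, *Algebraic Geometry I* (2nd ed. 2020), §(4.8)–(4.9) (fibre products, base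
  change), (14.20) (Galois twists ∕ descent data).
* [MumfordAV1970] D. Mumford, *Abelian Varieties* (1970), §7, Theorem p. 66.
* [SGA1] A. Grothendieck, *SGA 1*, Exp. V, Prop. 1.8.
-/

set_option autoImplicit false

noncomputable section

open CategoryTheory AlgebraicGeometry Limits

universe u

namespace Literature.AlgebraicGeometry.Motives

open Literature.AlgebraicGeometry.RelativeSpec
open Literature.AlgebraicGeometry.Motives.AbelianVariety (bcSpec specMap_algEquiv_comp_bcSpec)

variable (K L : Type u) [Field K] [Field L] [Algebra K L]

/-! ## §1 The thickening functor and the projection `π` -/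

/-- **The Galois thickening functor** `R_L : X ↦ (X ⊗_K L → Spec L → Spec K)`: base change to `L` (the tree's
`baseChange K L = Over.pullback (Spec L → Spec K)`) followed by restriction of scalars back to `K` (`Over.map`), i.e.
`X ×_K Spec L` regarded over `K`.  An `abbrev`, so that all `Over.pullback`∕`Over.map` lemmas apply.
[cite: GortzWedhorn2020, §(4.8)–(4.9)] -/
abbrev thickening : SchemeOver K ⥤ SchemeOver K :=
  baseChange K L ⋙ Over.map (bcSpec K L)

variable {K L}

/-- On objects the thickening is the tree's restriction of scalars of the base change:
`R_L X = (X ⊗_K L)|_K` (by `rfl`). [cite: GortzWedhorn2020, §(4.8)–(4.9)] -/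
theorem thickening_obj_eq_restrictScalars (X : SchemeOver K) :
    (thickening K L).obj X = SchemeOver.restrictScalars K ((baseChange K L).obj X) := rfl

/-- The underlying scheme of `R_L X` is `X ×_K Spec L`. [cite: GortzWedhorn2020, §(4.8)–(4.9)] -/
theorem thickening_obj_left (X : SchemeOver K) :
    ((thickening K L).obj X).left = pullback X.hom (bcSpec K L) := rfl

/-- The structure morphism of `R_L X` is `pr₂ ≫ (Spec L → Spec K)`. [cite: GortzWedhorn2020, §(4.8)–(4.9)] -/
theorem thickening_obj_hom (X : SchemeOver K) :
    ((thickening K L).obj X).hom = pullback.snd X.hom (bcSpec K L) ≫ bcSpec K L := rfl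

/-- On morphisms the thickening is `f ×_K Spec L` (the underlying morphism of the base change). [cite: GortzWedhorn2020, §(4.8)–(4.9)] -/
theorem thickening_map_left {X Y : SchemeOver K} (f : X ⟶ Y) :
    ((thickening K L).map f).left = ((baseChange K L).map f).left := rfl

/-- **The projection** `π_X : R_L X ⟶ X` over `K` (first projection of `X ×_K Spec L`; a `K`-morphism because
`pr₁ ≫ (X → Spec K) = pr₂ ≫ (Spec L → Spec K)`). [cite: GortzWedhorn2020, §(4.8)–(4.9)] -/
def thickeningπ (X : SchemeOver K) : (thickening K L).obj X ⟶ X :=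
  Over.homMk (pullback.fst X.hom (bcSpec K L)) (by
    change pullback.fst X.hom (bcSpec K L) ≫ X.hom = pullback.snd X.hom (bcSpec K L) ≫ bcSpec K L
    exact pullback.condition)

/-- `π_X.left = pr₁`. [cite: GortzWedhorn2020, §(4.8)–(4.9)] -/
@[simp]
theorem thickeningπ_left (X : SchemeOver K) : (thickeningπ (L := L) X).left = pullback.fst X.hom (bcSpec K L) := rfl

/-- `π` is natural in `X`: `R_L f ≫ π_Y = π_X ≫ f`. [cite: GortzWedhorn2020, §(4.8)–(4.9)] -/
theorem thickeningπ_naturality {X Y : SchemeOver K} (f : X ⟶ Y) :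
    (thickening K L).map f ≫ thickeningπ Y = thickeningπ X ≫ f := by
  apply Over.OverMorphism.ext
  exact pullback.lift_fst _ _ _

/-! ## §2 The Galois twists and the Galois action -/

/-- **The Galois twist** `1 × Spec σ` of `X ×_K Spec L` (`σ ∈ Aut(L ∕ K)`), a `K`-morphism, `σ`-semilinear over
`Spec L` (the twist of ★ `AbelianVariety.galTwist`, for an arbitrary `K`-scheme `X`). [cite: GortzWedhorn2020, (14.20)] -/
def thickTwist (X : SchemeOver K) (σ : L ≃ₐ[K] L) :
    pullback X.hom (bcSpec K L) ⟶ pullback X.hom (bcSpec K L) :=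
  pullback.map X.hom (bcSpec K L) X.hom (bcSpec K L) (𝟙 X.left)
    (Spec.map (CommRingCat.ofHom (σ : L →+* L))) (𝟙 _) (by simp)
    (by rw [Category.comp_id, specMap_algEquiv_comp_bcSpec])

/-- `(1 × Spec σ) ≫ pr₁ = pr₁`. [cite: GortzWedhorn2020, (14.20)] -/
@[reassoc (attr := simp)]
theorem thickTwist_fst (X : SchemeOver K) (σ : L ≃ₐ[K] L) :
    thickTwist X σ ≫ pullback.fst _ _ = pullback.fst _ _ :=
  (pullback.lift_fst _ _ _).trans (Category.comp_id _)

/-- `(1 × Spec σ) ≫ pr₂ = pr₂ ≫ Spec σ`. [cite: GortzWedhorn2020, (14.20)] -/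
@[reassoc (attr := simp)]
theorem thickTwist_snd (X : SchemeOver K) (σ : L ≃ₐ[K] L) :
    thickTwist X σ ≫ pullback.snd _ _ = pullback.snd _ _ ≫ Spec.map (CommRingCat.ofHom (σ : L →+* L)) :=
  pullback.lift_snd _ _ _

/-- Twist by `1` is the identity. [cite: GortzWedhorn2020, (14.20)] -/
@[simp]
theorem thickTwist_one (X : SchemeOver K) : thickTwist X (1 : L ≃ₐ[K] L) = 𝟙 _ := by
  have h1 : ((1 : L ≃ₐ[K] L) : L →+* L) = RingHom.id L := RingHom.ext fun _ ↦ rfl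
  apply pullback.hom_ext
  · rw [thickTwist_fst, Category.id_comp]
  · rw [thickTwist_snd, Category.id_comp, h1, CommRingCat.ofHom_id, Spec.map_id, Category.comp_id]

/-- Twists compose contravariantly: `1 × Spec (σ τ) = (1 × Spec σ) ≫ (1 × Spec τ)` (`Spec` is contravariant and
`σ * τ = σ ∘ τ`). [cite: GortzWedhorn2020, (14.20)] -/
theorem thickTwist_mul (X : SchemeOver K) (σ τ : L ≃ₐ[K] L) :
    thickTwist X (σ * τ) = thickTwist X σ ≫ thickTwist X τ := by
  have h1 : ((σ * τ : L ≃ₐ[K] L) : L →+* L) = (σ : L →+* L).comp τ := RingHom.ext fun _ ↦ rfl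
  apply pullback.hom_ext
  · rw [thickTwist_fst, Category.assoc, thickTwist_fst, thickTwist_fst]
  · rw [thickTwist_snd, Category.assoc, thickTwist_snd, thickTwist_snd_assoc, h1, CommRingCat.ofHom_comp,
      Spec.map_comp]

/-- The twist as an automorphism of `X ×_K Spec L`, with inverse the twist by `σ⁻¹`. [cite: GortzWedhorn2020, (14.20)] -/
@[simps]
def thickTwistIso (X : SchemeOver K) (σ : L ≃ₐ[K] L) : pullback X.hom (bcSpec K L) ≅ pullback X.hom (bcSpec K L) where
  hom := thickTwist X σ
  inv := thickTwist X σ⁻¹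
  hom_inv_id := by rw [← thickTwist_mul, mul_inv_cancel, thickTwist_one]
  inv_hom_id := by rw [← thickTwist_mul, inv_mul_cancel, thickTwist_one]

/-- **The Galois action on the thickening**: `σ ↦ 1 × Spec σ⁻¹`, a group homomorphism `Aut(L ∕ K) → Aut(X ×_K Spec L)`
(Mathlib's `Aut` composes as `g.trans f`) by automorphisms over `Spec K`: an ★ `ActionOver` of `Aut(L ∕ K)` on
`R_L X → Spec K` (the Galois group acting on `X ⊗_K L` through the second factor; [MumfordAV1970] §7, [SGA1] V §1).
[cite: GortzWedhorn2020, (14.20)] -/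
def thickeningGalAction (X : SchemeOver K) : ActionOver ((thickening K L).obj X).hom (L ≃ₐ[K] L) where
  aut :=
    { toFun := fun σ => thickTwistIso X σ⁻¹
      map_one' := by
        ext : 1
        change thickTwist X (1 : L ≃ₐ[K] L)⁻¹ = 𝟙 _
        rw [inv_one, thickTwist_one]
      map_mul' := fun σ τ => by
        ext : 1
        change thickTwist X (σ * τ)⁻¹ = thickTwist X τ⁻¹ ≫ thickTwist X σ⁻¹
        rw [mul_inv_rev, thickTwist_mul] }
  aut_comp := fun σ => by
    change thickTwist X σ⁻¹ ≫ pullback.snd X.hom (bcSpec K L) ≫ bcSpec K L = pullback.snd X.hom (bcSpec K L) ≫ bcSpec K L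
    rw [thickTwist_snd_assoc, specMap_algEquiv_comp_bcSpec]

/-- The action's automorphisms, as morphisms: `aut σ = 1 × Spec σ⁻¹`. [cite: GortzWedhorn2020, (14.20)] -/
@[simp]
theorem thickeningGalAction_aut_hom (X : SchemeOver K) (σ : L ≃ₐ[K] L) :
    ((thickeningGalAction X).aut σ).hom = thickTwist X σ⁻¹ := rfl

/-- `π_X` is invariant under the Galois action: `aut σ ≫ π_X = π_X`. [cite: MumfordAV1970, §7 Thm. p. 66] -/
theorem thickeningGalAction_comp_π (X : SchemeOver K) (σ : L ≃ₐ[K] L) :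
    ((thickeningGalAction X).aut σ).hom ≫ (thickeningπ (L := L) X).left = (thickeningπ X).left := by
  change thickTwist X σ⁻¹ ≫ pullback.fst X.hom (bcSpec K L) = pullback.fst X.hom (bcSpec K L)
  exact thickTwist_fst X σ⁻¹

/-! ## §3 The sections `ℓ_e` on `Ω`-points -/

section Lift

variable {Ω : Type u} [Field Ω] [Algebra K Ω] (e : L →ₐ[K] Ω)

/-- `Spec e ≫ (Spec L → Spec K) = (Spec Ω → Spec K)` for a `K`-algebra map `e : L → Ω`. [cite: GortzWedhorn2020, §(4.8)–(4.9)] -/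
@[reassoc]
theorem specMap_algHom_comp_bcSpec :
    Spec.map (CommRingCat.ofHom (e : L →+* Ω)) ≫ bcSpec K L = Spec.map (CommRingCat.ofHom (algebraMap K Ω)) := by
  rw [← Spec.map_comp, ← CommRingCat.ofHom_comp, AlgHom.comp_algebraMap]

/-- **The section `ℓ_e`** of `π_X` on `Ω`-points attached to a `K`-embedding `e : L → Ω`: `P ↦ (P, Spec e)` (an `Ω`-point
of `R_L X` over `K` is a pair of an `Ω`-point of `X` and a `K`-embedding of `L` into `Ω`). [cite: GortzWedhorn2020, §(4.8)–(4.9)] -/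
def thickeningLift (X : SchemeOver K) (P : AlgPoints X Ω) : AlgPoints ((thickening K L).obj X) Ω :=
  Over.homMk
    (pullback.lift P.left (Spec.map (CommRingCat.ofHom (e : L →+* Ω)))
      ((Over.w P).trans (specMap_algHom_comp_bcSpec e).symm))
    (by
      change pullback.lift _ _ _ ≫ pullback.snd X.hom (bcSpec K L) ≫ bcSpec K L =
        Spec.map (CommRingCat.ofHom (algebraMap K Ω))
      rw [pullback.lift_snd_assoc, specMap_algHom_comp_bcSpec])

/-- The underlying morphism of `ℓ_e P` is `(P, Spec e)`. [cite: GortzWedhorn2020, §(4.8)–(4.9)] -/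
theorem thickeningLift_left (X : SchemeOver K) (P : AlgPoints X Ω) :
    (thickeningLift e X P).left =
      pullback.lift P.left (Spec.map (CommRingCat.ofHom (e : L →+* Ω)))
        ((Over.w P).trans (specMap_algHom_comp_bcSpec e).symm) := rfl

/-- `ℓ_e P ≫ pr₁ = P`. [cite: GortzWedhorn2020, §(4.8)–(4.9)] -/
@[reassoc (attr := simp)]
theorem thickeningLift_left_comp_fst (X : SchemeOver K) (P : AlgPoints X Ω) :
    (thickeningLift e X P).left ≫ pullback.fst X.hom (bcSpec K L) = P.left :=
  pullback.lift_fst _ _ _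

/-- `ℓ_e P ≫ pr₂ = Spec e`. [cite: GortzWedhorn2020, §(4.8)–(4.9)] -/
@[reassoc (attr := simp)]
theorem thickeningLift_left_comp_snd (X : SchemeOver K) (P : AlgPoints X Ω) :
    (thickeningLift e X P).left ≫ pullback.snd X.hom (bcSpec K L) = Spec.map (CommRingCat.ofHom (e : L →+* Ω)) :=
  pullback.lift_snd _ _ _

/-- `π_X (ℓ_e P) = P`: `ℓ_e` is a section of `π_X` on `Ω`-points. [cite: GortzWedhorn2020, §(4.8)–(4.9)] -/
@[simp]
theorem map_thickeningπ_thickeningLift (X : SchemeOver K) (P : AlgPoints X Ω) :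
    AlgPoints.map (thickeningπ X) (thickeningLift e X P) = P := by
  apply Over.OverMorphism.ext
  exact pullback.lift_fst _ _ _

/-- `ℓ_e` is natural in `X`: `R_L f (ℓ_e P) = ℓ_e (f P)`. [cite: GortzWedhorn2020, §(4.8)–(4.9)] -/
theorem map_thickening_map_thickeningLift {X Y : SchemeOver K} (f : X ⟶ Y) (P : AlgPoints X Ω) :
    AlgPoints.map ((thickening K L).map f) (thickeningLift e X P) = thickeningLift e Y (AlgPoints.map f P) := by
  apply Over.OverMorphism.ext
  change pullback.lift P.left (Spec.map (CommRingCat.ofHom (e : L →+* Ω))) _ ≫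
      pullback.lift (pullback.fst X.hom (bcSpec K L) ≫ f.left) (pullback.snd X.hom (bcSpec K L)) _ =
    pullback.lift (P.left ≫ f.left) (Spec.map (CommRingCat.ofHom (e : L →+* Ω))) _
  apply pullback.hom_ext
  · rw [Category.assoc, pullback.lift_fst, pullback.lift_fst_assoc, pullback.lift_fst]
  · rw [Category.assoc, pullback.lift_snd, pullback.lift_snd, pullback.lift_snd]

/-- The action moves the sections: `(1 × Spec σ⁻¹) ∘ (P, Spec e) = (P, Spec (e ∘ σ⁻¹))`, i.e.
`aut σ (ℓ_e P) = ℓ_{e ∘ σ⁻¹} P` (the Galois group permutes the sheets `e`). [cite: GortzWedhorn2020, (14.20)] -/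
theorem aut_thickeningLift (X : SchemeOver K) (σ : L ≃ₐ[K] L) (P : AlgPoints X Ω) :
    (thickeningLift e X P).left ≫ ((thickeningGalAction X).aut σ).hom =
      (thickeningLift (e.comp (σ.symm : L →ₐ[K] L)) X P).left := by
  change pullback.lift _ _ _ ≫ thickTwist X σ⁻¹ = pullback.lift _ _ _
  apply pullback.hom_ext
  · rw [Category.assoc, thickTwist_fst, pullback.lift_fst, pullback.lift_fst]
  · rw [Category.assoc, thickTwist_snd, pullback.lift_snd_assoc, pullback.lift_snd]
    exact (Spec.map_comp (CommRingCat.ofHom ((σ⁻¹ : L ≃ₐ[K] L) : L →+* L)) (CommRingCat.ofHom (e : L →+* Ω))).symm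

/-- The same on `Ω`-points of `R_L X` over `K`: `aut σ · ℓ_e P = ℓ_{e ∘ σ⁻¹} P`. [cite: GortzWedhorn2020, (14.20)] -/
theorem map_aut_thickeningLift (X : SchemeOver K) (σ : L ≃ₐ[K] L) (P : AlgPoints X Ω) :
    AlgPoints.map (Over.homMk ((thickeningGalAction X).aut σ).hom ((thickeningGalAction X).aut_comp σ))
        (thickeningLift e X P) =
      thickeningLift (e.comp (σ.symm : L →ₐ[K] L)) X P := by
  apply Over.OverMorphism.ext
  exact aut_thickeningLift e X σ P

end Lift

/-! ## §4 The `Ω`-points of the thickening are the pairs (`Ω`-point of `X`, `K`-embedding `L → Ω`) -/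

section Points

variable {Ω : Type u} [Field Ω] [Algebra K Ω]

/-- The `K`-embedding `σ_P : L → Ω` attached to an `Ω`-point `P` of `R_L X` over `K` (the tree's ★ `AlgPoints.embOfPoint`
of the `L`-scheme `X ⊗_K L` regarded over `K`) is the second coordinate of `P`: `Spec σ_P = P ≫ pr₂`. [cite: GortzWedhorn2020, §(4.8)–(4.9)] -/
theorem specMap_embOfPoint_eq_comp_snd (X : SchemeOver K) (P : AlgPoints ((thickening K L).obj X) Ω) :
    Spec.map (CommRingCat.ofHom (AlgPoints.embOfPoint ((baseChange K L).obj X) P).toRingHom) =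
      P.left ≫ pullback.snd X.hom (bcSpec K L) :=
  AlgPoints.specMap_ofHom_embOfPoint _ P

/-- **Every `Ω`-point of `R_L X` over `K` is a pair**: `P = ℓ_{σ_P} (π_X P)`. [cite: GortzWedhorn2020, §(4.8)–(4.9)] -/
theorem thickeningLift_embOfPoint_map_thickeningπ (X : SchemeOver K) (P : AlgPoints ((thickening K L).obj X) Ω) :
    thickeningLift (AlgPoints.embOfPoint ((baseChange K L).obj X) P) X (AlgPoints.map (thickeningπ X) P) = P := by
  apply Over.OverMorphism.ext
  rw [thickeningLift_left]
  apply pullback.hom_ext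
  · rw [pullback.lift_fst]
    rfl
  · rw [pullback.lift_snd]
    exact specMap_embOfPoint_eq_comp_snd X P

/-- The embedding attached to `ℓ_e P` is `e`. [cite: GortzWedhorn2020, §(4.8)–(4.9)] -/
theorem embOfPoint_thickeningLift (e : L →ₐ[K] Ω) (X : SchemeOver K) (P : AlgPoints X Ω) :
    AlgPoints.embOfPoint ((baseChange K L).obj X) (thickeningLift e X P) = e := by
  have h := specMap_embOfPoint_eq_comp_snd X (thickeningLift e X P)
  rw [thickeningLift_left_comp_snd] at h
  have h' := congrArg (fun f : CommRingCat.of L ⟶ CommRingCat.of Ω => f.hom) (Spec.map_injective h)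
  exact AlgHom.ext fun x => congrFun (congrArg DFunLike.coe h') x

/-- **`(R_L X)(Ω) ≃ X(Ω) × Hom_K(L, Ω)`**: the `Ω`-points of the thickening over `K` are the pairs of an `Ω`-point of `X`
and a `K`-embedding of `L` into `Ω` (`P ↦ (π_X P, σ_P)`, inverse `(P, e) ↦ ℓ_e P`).  No hypothesis on `L ∕ K` or `Ω`.
[cite: GortzWedhorn2020, §(4.8)–(4.9)] -/
def thickeningPointsEquiv (X : SchemeOver K) : AlgPoints ((thickening K L).obj X) Ω ≃ AlgPoints X Ω × (L →ₐ[K] Ω) where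
  toFun P := (AlgPoints.map (thickeningπ X) P, AlgPoints.embOfPoint ((baseChange K L).obj X) P)
  invFun q := thickeningLift q.2 X q.1
  left_inv P := thickeningLift_embOfPoint_map_thickeningπ X P
  right_inv q := Prod.ext (map_thickeningπ_thickeningLift q.2 X q.1) (embOfPoint_thickeningLift q.2 X q.1)

/-- Unfolding `thickeningPointsEquiv`. [cite: GortzWedhorn2020, §(4.8)–(4.9)] -/
@[simp]
theorem thickeningPointsEquiv_apply (X : SchemeOver K) (P : AlgPoints ((thickening K L).obj X) Ω) :
    thickeningPointsEquiv X P = (AlgPoints.map (thickeningπ X) P, AlgPoints.embOfPoint ((baseChange K L).obj X) P) :=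
  rfl

/-- Unfolding the inverse of `thickeningPointsEquiv`: `(P, e) ↦ ℓ_e P`. [cite: GortzWedhorn2020, §(4.8)–(4.9)] -/
@[simp]
theorem thickeningPointsEquiv_symm_apply (X : SchemeOver K) (q : AlgPoints X Ω × (L →ₐ[K] Ω)) :
    (thickeningPointsEquiv X).symm q = thickeningLift q.2 X q.1 :=
  rfl

/-- In the pair description the Galois action is `σ · (P, e) = (P, e ∘ σ⁻¹)`. [cite: GortzWedhorn2020, (14.20)] -/
theorem thickeningPointsEquiv_map_aut (X : SchemeOver K) (σ : L ≃ₐ[K] L) (P : AlgPoints ((thickening K L).obj X) Ω) :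
    thickeningPointsEquiv X
        (AlgPoints.map (Over.homMk ((thickeningGalAction X).aut σ).hom ((thickeningGalAction X).aut_comp σ)) P) =
      ((thickeningPointsEquiv X P).1, (thickeningPointsEquiv X P).2.comp (σ.symm : L →ₐ[K] L)) := by
  conv_lhs => rw [← thickeningLift_embOfPoint_map_thickeningπ X P]
  rw [map_aut_thickeningLift, thickeningPointsEquiv_apply, thickeningPointsEquiv_apply,
    map_thickeningπ_thickeningLift, embOfPoint_thickeningLift]

end Points

end Literature.AlgebraicGeometry.Motives

end
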